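import Summits.ResolutionOfSingularities.ResolutionOfSingularities.Theorems.FrobeniusClosingSteerRsopMonomialStep
import Summits.ResolutionOfSingularities.ResolutionOfSingularities.Theorems.FrobeniusClosingSteerSwitchingSetup
import Summits.ResolutionOfSingularities.ResolutionOfSingularities.Theorems.FrobeniusClosingSteerSwitchingExit
import Summits.ResolutionOfSingularities.ResolutionOfSingularities.Theorems.FrobeniusClosingSteerSwitchingAssembly
import Summits.ResolutionOfSingularities.ResolutionOfSingularities.Theorems.FrobeniusClosingSteerSwitchingAssemblySeq
import HarnessLib

/-!
# Torsor local uniformization along strongly switching archimedean valuations, defectless case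

Crux `FrobeniusClosing.Steer` (item `stmt-ResolutionOfSingularities-16345`, shared with `WildCones`,
`JacobianBudget`, `EscapeRate`), line `switching-dichotomy` (lead prover-line-stmt-ResolutionOfSingularities-16345-0):
the line's TRUE `L`-sized lemma `stub_switchingDefectless`, now unconditional — the composition of the
landed stubs `stub_rsopMonomialStep` (p167176), `stub_switchingSetup` (p166601), `stub_switchingExit`
(p166891) with the assembly `stub_switchingAssembly` (p167646, rank-one form) resp.
`stub_switchingAssemblySeq` (r4, parameter-archimedean form).

**Theorem** (`switchingDefectless`). Let `k ⊆ K` be fields of characteristic `p`, `O` a valuation ring of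
`K`, `A₀ ⊆ O` a finitely generated `k`-subalgebra regular at the centre `𝔪_O ∩ A₀`, and `t ∈ K` with
`t ^ p ∈ A₀`, `Frac (A₀[t]) = K`. Assume
* (strongly switching) every element of `O` which is a fraction of elements of `A₀` lies in some member
  of the sequence of quadratic transforms of `(A₀)_{𝔪_O ∩ A₀}` along `O` (Shannon 1973; Granja 2004;
  Heinzer–Loper–Olberding–Schoutens–Toeniskoetter, Discussion 4.2);
* (archimedean) the valuation restricted to the fractions of `A₀` has rank one: for fractions `x, y` with
  `y ≠ 0` and `v(x) > 0` some power of `x` has value beyond `v(y)`;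
* (defectless) some fraction `g` has `v(t ^ p − g ^ p) ∉ v((Frac A₀)^{×p})`.
Then there is a finitely generated `A ⊇ A₀` with `t ∈ A ⊆ O`, `Frac A = K`, regular at the centre of `O`.

`switchingDefectlessSeq` is the same with (archimedean) weakened to (parameter-archimedean along the sequence):
every non-zero fraction of positive value is dominated by a power of a one-element part of a regular system
of parameters of SOME member of the quadratic sequence — true in rank one (`archSeq_of_arch`) and for
height-one-directed sequences along an exceptional prime divisor (rank two).

No perfectness and no bound on the dimension are needed. Proof: see the module docstrings of the four
stub files; in one breath — the witness `g` lies in `O`, hence in some `R i₀`; for a regular parameter `x`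
of `R i₀` archimedeanity gives `xⁿ / (t^p − g^p) ∈ O ∩ Frac A₀ ⊆ R N`, so `t^p − g^p` divides `xⁿ`, a
monomial in a part of a regular system of parameters of `R N` times a unit (HLOST Lemma 2.7 iterated), hence
is itself such a monomial times a unit, with an exponent prime to `p` by defectlessness; the toroidal exit
(`stub_toroidalExit`, Kato 1994 (10.4)) on a finitely generated model of `R N` concludes.
-/

-- `Summit.<S>.<S>.…` duplicates the summit name by design (D-0017, single-problem summit).
set_option linter.dupNamespace false

open IsLocalRing
open Literature.AlgebraicGeometry.Resolution

namespace Summit.ResolutionOfSingularities.ResolutionOfSingularities.Theorems.SwitchingDichotomy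

/-- **Torsor local uniformization in the strongly switching, archimedean, defectless regime** (every
dimension, every ground field of characteristic `p`): for `A₀ ⊆ O` finitely generated and regular at the
centre, `t ^ p ∈ A₀`, `Frac (A₀[t]) = K`, if the quadratic sequence of `(A₀)_{centre}` along `O` exhausts
`O ∩ Frac A₀`, the valuation is archimedean on `Frac A₀`, and `t ^ p` has a defectless `p`-th-power
approximation from `Frac A₀`, then some finitely generated `A ⊇ A₀[t]`, `A ⊆ O`, `Frac A = K`, is regular at
the centre of `O`. This is the statement `Sig.stub_switchingDefectless` of the line `switching-dichotomy`
(crux `FrobeniusClosing.Steer`), unfolded. [cite: HeinzerEtAl2015, Prop. 4.4 and Lemma 2.7]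
[cite: Kato1994, (10.4)] -/
theorem switchingDefectless :
    ∀ p : ℕ, p.Prime → ∀ (k K : Type) [Field k] [CharP k p] [Field K] [Algebra k K]
      (O : ValuationSubring K) (A₀ : Subalgebra k K) (h₀ : A₀.toSubring ≤ O.toSubring) (t : K),
      A₀.FG → t ^ p ∈ A₀ → IsFractionRing (Algebra.adjoin k (insert t (A₀ : Set K))) K →
      IsRegularLocalRing (Localization.AtPrime
        (Ideal.comap (Subring.inclusion h₀) (IsLocalRing.maximalIdeal O))) →
      (∀ R : ℕ → Subring K, R 0 = locAtCentre A₀.toSubring O →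
        (∀ i, IsQuadraticTransformAlong O (R i) (R (i + 1))) →
        ∀ x : K, x ∈ O → (∃ y ∈ A₀, ∃ z ∈ A₀, z ≠ 0 ∧ x = y / z) → ∃ i, x ∈ R i) →
      (∀ x y : K, (∃ a ∈ A₀, ∃ b ∈ A₀, b ≠ 0 ∧ x = a / b) → (∃ a ∈ A₀, ∃ b ∈ A₀, b ≠ 0 ∧ y = a / b) →
        y ≠ 0 → O.valuation x < 1 → ∃ n : ℕ, O.valuation x ^ n < O.valuation y) →
      ¬ (∀ g : K, (∃ a ∈ A₀, ∃ b ∈ A₀, b ≠ 0 ∧ g = a / b) →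
        ∃ w : K, (∃ a ∈ A₀, ∃ b ∈ A₀, b ≠ 0 ∧ w = a / b) ∧
          O.valuation (t ^ p - g ^ p) = O.valuation (w ^ p)) →
      ∃ (A : Subalgebra k K) (h : A.toSubring ≤ O.toSubring), A₀ ≤ A ∧ t ∈ A ∧ A.FG ∧
        IsFractionRing A K ∧ IsRegularLocalRing (Localization.AtPrime
          (Ideal.comap (Subring.inclusion h) (IsLocalRing.maximalIdeal O))) :=
  stub_switchingAssembly stub_rsopMonomialStep stub_switchingSetup stub_switchingExit

/-- **Torsor local uniformization in the strongly switching, PARAMETER-archimedean, defectless regime**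
(every dimension, every ground field of characteristic `p`): as `switchingDefectless`, with archimedeanity
on `Frac A₀` weakened to: every non-zero fraction `y` of `A₀` of positive value is dominated by a power of
a one-element part `z` of a regular system of parameters of some member `R i` of the quadratic sequence of
`(A₀)_{centre}` along `O` (`v((z 0)^n) < v(y)`). This is the statement `Sig.stub_switchingDefectless` of
the reshaped (r4) line `switching-dichotomy`, unfolded; it covers in addition Granja's height-one-directed
sequences along an exceptional divisor. [cite: HeinzerEtAl2015, Prop. 4.4, Lemma 2.7 and Remark 2.4]
[cite: Kato1994, (10.4)] -/
theorem switchingDefectlessSeq :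
    ∀ p : ℕ, p.Prime → ∀ (k K : Type) [Field k] [CharP k p] [Field K] [Algebra k K]
      (O : ValuationSubring K) (A₀ : Subalgebra k K) (h₀ : A₀.toSubring ≤ O.toSubring) (t : K),
      A₀.FG → t ^ p ∈ A₀ → IsFractionRing (Algebra.adjoin k (insert t (A₀ : Set K))) K →
      IsRegularLocalRing (Localization.AtPrime
        (Ideal.comap (Subring.inclusion h₀) (IsLocalRing.maximalIdeal O))) →
      (∀ R : ℕ → Subring K, R 0 = locAtCentre A₀.toSubring O →
        (∀ i, IsQuadraticTransformAlong O (R i) (R (i + 1))) →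
        ∀ x : K, x ∈ O → (∃ y ∈ A₀, ∃ z ∈ A₀, z ≠ 0 ∧ x = y / z) → ∃ i, x ∈ R i) →
      (∀ R : ℕ → Subring K, R 0 = locAtCentre A₀.toSubring O →
        (∀ i, IsQuadraticTransformAlong O (R i) (R (i + 1))) →
        ∀ y : K, (∃ a ∈ A₀, ∃ b ∈ A₀, b ≠ 0 ∧ y = a / b) → y ≠ 0 → O.valuation y < 1 →
          ∃ (i : ℕ) (_ : IsLocalRing (R i)) (z : Fin 1 → R i), IsRsopPart z ∧
            ∃ n : ℕ, O.valuation ((z 0 : R i) : K) ^ n < O.valuation y) →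
      ¬ (∀ g : K, (∃ a ∈ A₀, ∃ b ∈ A₀, b ≠ 0 ∧ g = a / b) →
        ∃ w : K, (∃ a ∈ A₀, ∃ b ∈ A₀, b ≠ 0 ∧ w = a / b) ∧
          O.valuation (t ^ p - g ^ p) = O.valuation (w ^ p)) →
      ∃ (A : Subalgebra k K) (h : A.toSubring ≤ O.toSubring), A₀ ≤ A ∧ t ∈ A ∧ A.FG ∧
        IsFractionRing A K ∧ IsRegularLocalRing (Localization.AtPrime
          (Ideal.comap (Subring.inclusion h) (IsLocalRing.maximalIdeal O))) :=
  stub_switchingAssemblySeq stub_rsopMonomialStep stub_switchingSetup stub_switchingExit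

end Summit.ResolutionOfSingularities.ResolutionOfSingularities.Theorems.SwitchingDichotomy
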